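import Mathlib
import Literature.MathematicalPhysics.QuantumLattice.YangMillsClassical
import Literature.MathematicalPhysics.QuantumLattice.GrassmannIntegralProofs
import Summits.QuantumFields.QCD.Theorems.NestedDissectionSeaEarlyCrosserLawZeroModeRegularity
import Summits.QuantumFields.QCD.Theorems.NestedDissectionSeaEarlyCrosserLawZeroModeHolder
import Summits.QuantumFields.QCD.Theorems.NestedDissectionSeaEarlyCrosserLawZeroModeChirality
import HarnessLib

/-!
# Zero-mode action floor — the curvature-term bound via chirality, Cauchy–Schwarz and Kato–Sobolev
(lead c7, line `zero-mode-floor-dilute-gas` of crux `NestedDissectionSea.EarlyCrosserLaw`, stmt-QuantumFields-13995)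

Helper for the registered stub `stub_floorAssembly`.  GIVEN the cut-off Kato–Sobolev bound (the
conclusion of the registered stub `stub_katoSobolevCutoff`) as a hypothesis: if a continuous `W` is
dominated pointwise by `g₁ |ψ₊|² + g₂ |ψ₋|²` with continuous `gᵢ ≥ 0`, `∫ gᵢ² ≤ T²`, then for every smooth
compactly supported cut-off `χ` and `θ > 0`
`∫ χ² W ≤ T · (√6/8π) · [(1+θ)(4/5) ∫ χ²|∇ψ|² + (1+θ⁻¹) ∫ ‖dχ‖²|ψ|²]`
(apply Kato–Sobolev to the two chirality projections, which are again Dirac-harmonic, and add).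
-/

noncomputable section

open scoped BigOperators Matrix ContDiff Matrix.Norms.Frobenius
open MeasureTheory Literature.MathematicalPhysics.QuantumLattice

namespace Summit.QuantumFields.QCD.Cruxes.EarlyCrosserLaw.ZeroModeFloorDiluteGas

/-- **Curvature-term bound.**  See the module docstring. -/
theorem curvature_term_bound
    (hKS : ∀ (A : Connection (EuclideanSpace ℝ (Fin 4)) (Matrix (Fin 3) (Fin 3) ℂ)) (ψ : EuclideanSpace ℝ (Fin 4) → Fin 4 → Fin 3 → ℂ) (χ : EuclideanSpace ℝ (Fin 4) → ℝ) (θ : ℝ), IsSmoothConnection A → (∀ x v, (A x v)ᴴ = -(A x v)) → ContDiff ℝ ((⊤ : ℕ∞) : WithTop ℕ∞) ψ → (∀ x s c, ∑ μ : Fin 4, ∑ s' : Fin 4, euclideanGamma μ s s' * (fderiv ℝ (fun y => ψ y s' c) x (EuclideanSpace.single μ (1 : ℝ)) + ∑ c' : Fin 3, A x (EuclideanSpace.single μ (1 : ℝ)) c c' * ψ x s' c') = 0) → ContDiff ℝ ((⊤ : ℕ∞) : WithTop ℕ∞) χ → HasCompactSupport χ → 0 < θ → Real.sqrt (∫ x,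 χ x ^ 4 * (∑ s, ∑ c, ‖ψ x s c‖ ^ 2) ^ 2) ≤ (Real.sqrt 6 / (8 * Real.pi)) * ((1 + θ) * (4 / 5 : ℝ) * (∫ x, χ x ^ 2 * (∑ μ : Fin 4, ∑ s, ∑ c, ‖fderiv ℝ (fun z => ψ z s c) x (EuclideanSpace.single μ (1 : ℝ)) + ∑ c' : Fin 3, A x (EuclideanSpace.single μ (1 : ℝ)) c c' * ψ x s c'‖ ^ 2)) + (1 + θ⁻¹) * (∫ x, ‖fderiv ℝ χ x‖ ^ 2 * (∑ s, ∑ c, ‖ψ x s c‖ ^ 2))))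
    (A : Connection (EuclideanSpace ℝ (Fin 4)) (Matrix (Fin 3) (Fin 3) ℂ))
    (ψ : EuclideanSpace ℝ (Fin 4) → Fin 4 → Fin 3 → ℂ)
    (hA : IsSmoothConnection A) (hAH : ∀ x v, (A x v)ᴴ = -(A x v)) (hψ : ContDiff ℝ ∞ ψ)
    (hD : ∀ x s c, ∑ μ : Fin 4, ∑ s' : Fin 4, euclideanGamma μ s s' *
      (fderiv ℝ (fun y => ψ y s' c) x (EuclideanSpace.single μ (1 : ℝ)) +
        ∑ c' : Fin 3, A x (EuclideanSpace.single μ (1 : ℝ)) c c' * ψ x s' c') = 0)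
    (W g₁ g₂ : EuclideanSpace ℝ (Fin 4) → ℝ) (hWc : Continuous W)
    (hg₁c : Continuous g₁) (hg₂c : Continuous g₂) (hg₁0 : ∀ x, 0 ≤ g₁ x) (hg₂0 : ∀ x, 0 ≤ g₂ x)
    (hg₁i : Integrable (fun x => g₁ x ^ 2)) (hg₂i : Integrable (fun x => g₂ x ^ 2))
    (T : ℝ) (hT : 0 ≤ T) (hg₁T : ∫ x, g₁ x ^ 2 ≤ T ^ 2) (hg₂T : ∫ x, g₂ x ^ 2 ≤ T ^ 2)
    (hWle : ∀ x, W x ≤ g₁ x * (∑ c : Fin 3, (‖ψ x 0 c‖ ^ 2 + ‖ψ x 1 c‖ ^ 2)) +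
      g₂ x * (∑ c : Fin 3, (‖ψ x 2 c‖ ^ 2 + ‖ψ x 3 c‖ ^ 2)))
    (χ : EuclideanSpace ℝ (Fin 4) → ℝ) (hχ : ContDiff ℝ ∞ χ) (hχs : HasCompactSupport χ) (θ : ℝ) (hθ : 0 < θ) :
    ∫ x, χ x ^ 2 * W x ≤ T * (Real.sqrt 6 / (8 * Real.pi)) *
      ((1 + θ) * (4 / 5 : ℝ) * (∫ x, χ x ^ 2 * (∑ μ : Fin 4, ∑ s, ∑ c,
          ‖fderiv ℝ (fun z => ψ z s c) x (EuclideanSpace.single μ (1 : ℝ)) +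
            ∑ c' : Fin 3, A x (EuclideanSpace.single μ (1 : ℝ)) c c' * ψ x s c'‖ ^ 2))
        + (1 + θ⁻¹) * (∫ x, ‖fderiv ℝ χ x‖ ^ 2 * (∑ s, ∑ c, ‖ψ x s c‖ ^ 2))) := by
  -- Kato–Sobolev for the two chirality projections (both again Dirac-harmonic)
  have hKU := hKS A (fun x (s : Fin 4) (c : Fin 3) => if (s : ℕ) < 2 then ψ x s c else 0) χ θ hA hAH
    (contDiff_chiralUpper hψ) (dirac_chiralUpper A ψ hD) hχ hχs hθ
  have hKL := hKS A (fun x (s : Fin 4) (c : Fin 3) => if (s : ℕ) < 2 then 0 else ψ x s c) χ θ hA hAH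
    (contDiff_chiralLower hψ) (dirac_chiralLower A ψ hD) hχ hχs hθ
  simp only [normSq_chiralUpper, gradSq_chiralUpper] at hKU
  simp only [normSq_chiralLower, gradSq_chiralLower] at hKL
  -- abbreviations (introduced only now, so that they do not interfere with the rewriting above)
  set S₄ : ℝ := Real.sqrt 6 / (8 * Real.pi) with hS₄
  set nU : EuclideanSpace ℝ (Fin 4) → ℝ := fun x => ∑ c : Fin 3, (‖ψ x 0 c‖ ^ 2 + ‖ψ x 1 c‖ ^ 2) with hnU
  set nL : EuclideanSpace ℝ (Fin 4) → ℝ := fun x => ∑ c : Fin 3, (‖ψ x 2 c‖ ^ 2 + ‖ψ x 3 c‖ ^ 2) with hnL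
  set GU : EuclideanSpace ℝ (Fin 4) → ℝ := fun x => ∑ μ : Fin 4, ∑ c : Fin 3,
    (‖fderiv ℝ (fun z => ψ z 0 c) x (EuclideanSpace.single μ (1 : ℝ)) +
        ∑ c' : Fin 3, A x (EuclideanSpace.single μ (1 : ℝ)) c c' * ψ x 0 c'‖ ^ 2 +
      ‖fderiv ℝ (fun z => ψ z 1 c) x (EuclideanSpace.single μ (1 : ℝ)) +
        ∑ c' : Fin 3, A x (EuclideanSpace.single μ (1 : ℝ)) c c' * ψ x 1 c'‖ ^ 2) with hGU
  set GV : EuclideanSpace ℝ (Fin 4) → ℝ := fun x => ∑ μ : Fin 4, ∑ c : Fin 3,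
    (‖fderiv ℝ (fun z => ψ z 2 c) x (EuclideanSpace.single μ (1 : ℝ)) +
        ∑ c' : Fin 3, A x (EuclideanSpace.single μ (1 : ℝ)) c c' * ψ x 2 c'‖ ^ 2 +
      ‖fderiv ℝ (fun z => ψ z 3 c) x (EuclideanSpace.single μ (1 : ℝ)) +
        ∑ c' : Fin 3, A x (EuclideanSpace.single μ (1 : ℝ)) c c' * ψ x 3 c'‖ ^ 2) with hGV
  -- continuity
  have hψc : ∀ s c, Continuous fun x => ψ x s c := fun s c => (contDiff_spinor_component hψ s c).continuous
  have hcovc : ∀ (μ s : Fin 4) (c : Fin 3), Continuous fun x =>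
      fderiv ℝ (fun z => ψ z s c) x (EuclideanSpace.single μ (1 : ℝ)) +
        ∑ c' : Fin 3, A x (EuclideanSpace.single μ (1 : ℝ)) c c' * ψ x s c' :=
    fun μ s c => (contDiff_covDeriv_component hA hψ μ s c).continuous
  have hnUc : Continuous nU :=
    continuous_finsetSum _ fun c _ => (((hψc 0 c).norm).pow 2).add (((hψc 1 c).norm).pow 2)
  have hnLc : Continuous nL :=
    continuous_finsetSum _ fun c _ => (((hψc 2 c).norm).pow 2).add (((hψc 3 c).norm).pow 2)
  have hGUc : Continuous GU :=
    continuous_finsetSum _ fun μ _ => continuous_finsetSum _ fun c _ =>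
      (((hcovc μ 0 c).norm).pow 2).add (((hcovc μ 1 c).norm).pow 2)
  have hGVc : Continuous GV :=
    continuous_finsetSum _ fun μ _ => continuous_finsetSum _ fun c _ =>
      (((hcovc μ 2 c).norm).pow 2).add (((hcovc μ 3 c).norm).pow 2)
  have hχc : Continuous χ := hχ.continuous
  have hdχn : Continuous fun x => ‖fderiv ℝ χ x‖ ^ 2 := ((hχ.continuous_fderiv (by simp)).norm).pow 2
  have hnU0 : ∀ x, 0 ≤ nU x := fun x =>
    Finset.sum_nonneg fun c _ => add_nonneg (sq_nonneg _) (sq_nonneg _)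
  have hnL0 : ∀ x, 0 ≤ nL x := fun x =>
    Finset.sum_nonneg fun c _ => add_nonneg (sq_nonneg _) (sq_nonneg _)
  -- compact supports
  have hχ2s : HasCompactSupport fun x => χ x ^ 2 := by
    have : (fun x => χ x ^ 2) = fun x => χ x * χ x := funext fun x => sq _
    rw [this]; exact hχs.mul_right
  have hdχs : HasCompactSupport fun x => ‖fderiv ℝ χ x‖ ^ 2 := by
    have h1 : HasCompactSupport fun x => ‖fderiv ℝ χ x‖ := (hχs.fderiv (𝕜 := ℝ)).norm
    have : (fun x => ‖fderiv ℝ χ x‖ ^ 2) = fun x => ‖fderiv ℝ χ x‖ * ‖fderiv ℝ χ x‖ := funext fun x => sq _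
    rw [this]; exact h1.mul_right
  -- integrability
  have iW : Integrable fun x => χ x ^ 2 * W x :=
    ((hχc.pow 2).mul hWc).integrable_of_hasCompactSupport hχ2s.mul_right
  have iU : Integrable fun x => g₁ x * (χ x ^ 2 * nU x) :=
    (hg₁c.mul ((hχc.pow 2).mul hnUc)).integrable_of_hasCompactSupport (hχ2s.mul_right).mul_left
  have iL : Integrable fun x => g₂ x * (χ x ^ 2 * nL x) :=
    (hg₂c.mul ((hχc.pow 2).mul hnLc)).integrable_of_hasCompactSupport (hχ2s.mul_right).mul_left
  have iXU : Integrable fun x => χ x ^ 2 * GU x :=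
    ((hχc.pow 2).mul hGUc).integrable_of_hasCompactSupport hχ2s.mul_right
  have iXV : Integrable fun x => χ x ^ 2 * GV x :=
    ((hχc.pow 2).mul hGVc).integrable_of_hasCompactSupport hχ2s.mul_right
  have iEU : Integrable fun x => ‖fderiv ℝ χ x‖ ^ 2 * nU x :=
    (hdχn.mul hnUc).integrable_of_hasCompactSupport hdχs.mul_right
  have iEL : Integrable fun x => ‖fderiv ℝ χ x‖ ^ 2 * nL x :=
    (hdχn.mul hnLc).integrable_of_hasCompactSupport hdχs.mul_right
  -- step 1: the pointwise chirality/Clifford bound, integrated against `χ²`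
  have h1 : ∫ x, χ x ^ 2 * W x ≤ (∫ x, g₁ x * (χ x ^ 2 * nU x)) + ∫ x, g₂ x * (χ x ^ 2 * nL x) := by
    rw [← integral_add iU iL]
    refine integral_mono iW (iU.add iL) fun x => ?_
    have hχ2 : 0 ≤ χ x ^ 2 := sq_nonneg _
    have hle : χ x ^ 2 * W x ≤ χ x ^ 2 * (g₁ x * nU x + g₂ x * nL x) :=
      mul_le_mul_of_nonneg_left (hWle x) hχ2
    show χ x ^ 2 * W x ≤ g₁ x * (χ x ^ 2 * nU x) + g₂ x * (χ x ^ 2 * nL x)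
    linarith [hle]
  -- step 2: `L²` Cauchy–Schwarz
  have h2U : ∫ x, g₁ x * (χ x ^ 2 * nU x)
      ≤ Real.sqrt (∫ x, g₁ x ^ 2) * Real.sqrt (∫ x, (χ x ^ 2 * nU x) ^ 2) :=
    integral_mul_le_sqrt_mul_sqrt hg₁c hg₁0 hg₁i ((hχc.pow 2).mul hnUc) hχ2s.mul_right
      fun x => mul_nonneg (sq_nonneg _) (hnU0 x)
  have h2L : ∫ x, g₂ x * (χ x ^ 2 * nL x)
      ≤ Real.sqrt (∫ x, g₂ x ^ 2) * Real.sqrt (∫ x, (χ x ^ 2 * nL x) ^ 2) :=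
    integral_mul_le_sqrt_mul_sqrt hg₂c hg₂0 hg₂i ((hχc.pow 2).mul hnLc) hχ2s.mul_right
      fun x => mul_nonneg (sq_nonneg _) (hnL0 x)
  -- step 3: `‖gᵢ‖₂ ≤ T`
  have h3U : Real.sqrt (∫ x, g₁ x ^ 2) ≤ T :=
    (Real.sqrt_le_sqrt hg₁T).trans_eq (Real.sqrt_sq hT)
  have h3L : Real.sqrt (∫ x, g₂ x ^ 2) ≤ T :=
    (Real.sqrt_le_sqrt hg₂T).trans_eq (Real.sqrt_sq hT)
  -- step 4: Kato–Sobolev for the projections, in the present notation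
  have h4U : Real.sqrt (∫ x, (χ x ^ 2 * nU x) ^ 2)
      ≤ S₄ * ((1 + θ) * (4 / 5 : ℝ) * (∫ x, χ x ^ 2 * GU x) + (1 + θ⁻¹) * ∫ x, ‖fderiv ℝ χ x‖ ^ 2 * nU x) := by
    have e1 : (fun x => (χ x ^ 2 * nU x) ^ 2) = fun x => χ x ^ 4 * (nU x) ^ 2 := funext fun x => by ring
    rw [e1]
    exact hKU
  have h4L : Real.sqrt (∫ x, (χ x ^ 2 * nL x) ^ 2)
      ≤ S₄ * ((1 + θ) * (4 / 5 : ℝ) * (∫ x, χ x ^ 2 * GV x) + (1 + θ⁻¹) * ∫ x, ‖fderiv ℝ χ x‖ ^ 2 * nL x) := by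
    have e1 : (fun x => (χ x ^ 2 * nL x) ^ 2) = fun x => χ x ^ 4 * (nL x) ^ 2 := funext fun x => by ring
    rw [e1]
    exact hKL
  -- step 5: combine
  have h5U : ∫ x, g₁ x * (χ x ^ 2 * nU x)
      ≤ T * (S₄ * ((1 + θ) * (4 / 5 : ℝ) * (∫ x, χ x ^ 2 * GU x) + (1 + θ⁻¹) * ∫ x, ‖fderiv ℝ χ x‖ ^ 2 * nU x)) :=
    h2U.trans (mul_le_mul h3U h4U (Real.sqrt_nonneg _) hT)
  have h5L : ∫ x, g₂ x * (χ x ^ 2 * nL x)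
      ≤ T * (S₄ * ((1 + θ) * (4 / 5 : ℝ) * (∫ x, χ x ^ 2 * GV x) + (1 + θ⁻¹) * ∫ x, ‖fderiv ℝ χ x‖ ^ 2 * nL x)) :=
    h2L.trans (mul_le_mul h3L h4L (Real.sqrt_nonneg _) hT)
  -- step 6: the densities split along the chirality decomposition
  have hX : (∫ x, χ x ^ 2 * (∑ μ : Fin 4, ∑ s, ∑ c,
          ‖fderiv ℝ (fun z => ψ z s c) x (EuclideanSpace.single μ (1 : ℝ)) +
            ∑ c' : Fin 3, A x (EuclideanSpace.single μ (1 : ℝ)) c c' * ψ x s c'‖ ^ 2))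
      = (∫ x, χ x ^ 2 * GU x) + ∫ x, χ x ^ 2 * GV x := by
    rw [← integral_add iXU iXV]
    refine integral_congr_ae (ae_of_all _ fun x => ?_)
    show χ x ^ 2 * _ = χ x ^ 2 * GU x + χ x ^ 2 * GV x
    rw [gradSq_split A ψ x, mul_add]
  have hE : (∫ x, ‖fderiv ℝ χ x‖ ^ 2 * (∑ s, ∑ c, ‖ψ x s c‖ ^ 2))
      = (∫ x, ‖fderiv ℝ χ x‖ ^ 2 * nU x) + ∫ x, ‖fderiv ℝ χ x‖ ^ 2 * nL x := by
    rw [← integral_add iEU iEL]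
    refine integral_congr_ae (ae_of_all _ fun x => ?_)
    show ‖fderiv ℝ χ x‖ ^ 2 * _ = ‖fderiv ℝ χ x‖ ^ 2 * nU x + ‖fderiv ℝ χ x‖ ^ 2 * nL x
    rw [normSq_split ψ x, mul_add]
  rw [hX, hE]
  calc ∫ x, χ x ^ 2 * W x
      ≤ (∫ x, g₁ x * (χ x ^ 2 * nU x)) + ∫ x, g₂ x * (χ x ^ 2 * nL x) := h1
    _ ≤ T * (S₄ * ((1 + θ) * (4 / 5 : ℝ) * (∫ x, χ x ^ 2 * GU x) + (1 + θ⁻¹) * ∫ x, ‖fderiv ℝ χ x‖ ^ 2 * nU x))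
        + T * (S₄ * ((1 + θ) * (4 / 5 : ℝ) * (∫ x, χ x ^ 2 * GV x) + (1 + θ⁻¹) * ∫ x, ‖fderiv ℝ χ x‖ ^ 2 * nL x)) :=
      add_le_add h5U h5L
    _ = T * S₄ * ((1 + θ) * (4 / 5 : ℝ) * ((∫ x, χ x ^ 2 * GU x) + ∫ x, χ x ^ 2 * GV x)
        + (1 + θ⁻¹) * ((∫ x, ‖fderiv ℝ χ x‖ ^ 2 * nU x) + ∫ x, ‖fderiv ℝ χ x‖ ^ 2 * nL x)) := by ring

end Summit.QuantumFields.QCD.Cruxes.EarlyCrosserLaw.ZeroModeFloorDiluteGas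

end
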